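/-
Copyright: public domain mathematics; formalisation notes by the eng-sdp-4 engines lane (shared numerical
engines serving client cells; rigour lives in the verifiers).
-/
import Literature.MathematicalPhysics.QuantumFieldTheory.O2ExtBlockTables
import Literature.MathematicalPhysics.QuantumFieldTheory.ConformalBootstrap3D.DiagonalTailRatioBoundWide
import HarnessLib

/-!
# O(2) `{φ, s, t}` scan: the diagonal-bound tables of the external channels in closed form on a box

`O2ExtBlockTables.fTable_on_dbox` turns `D`-uniform head / diagonal-bound / radius tables into the
`F`-tables of an external channel at every `D` of a box of external dimensions `[lo, hi]`; its one
hypothesis that is not a closed-form check is the DIAGONAL-BOUND TABLE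
`hU : ∀ D ∈ [lo, hi], DiagBoundTable D S (Δc D) y' Ua Ub`, i.e. ONE number `Ua L ≥ D(a_L(D); Δc(D); y')`
and one `Ub L ≥ D(b_L(D); Δc(D); y')` per label, valid at every `D` of the box, where
`a_L = −Δ_ij(L)/2`, `b_L = Δ_kl(L)/2` are the block parameters of the label (differences of two external
dimensions, or `0`). `ConformalBootstrap3D.diagSeriesAB_le_boxBound_wide` bounds the reflection-positive
diagonal series by ONE closed-form number on a parameter box `(Δ, c) ∈ [Δ₁, Δ₂] × [c₁, c₂]`
(`c₁ ≥ −5/8`) from two finite corner tests. This file joins the two: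

1. **Parameter corner boxes** (`d12Mix`, `d34Mix`, `parALo/parAHi/parBLo/parBHi`): on `D ∈ [lo, hi]`
   each `Δ_ij(L)(D)`, `Δ_kl(L)(D)` lies between its MIXED-corner values (first dimension from one
   corner, second from the other), hence `a_L(D) ∈ [parALo lo hi L, parAHi lo hi L]` and
   `b_L(D) ∈ [parBLo lo hi L, parBHi lo hi L]` (`blockParA_mem_Icc`, `blockParB_mem_Icc`).
2. **The diagonal-bound table on a box from per-label corner tests** (`DiagCornerTests`,
   `diagBoundTable_on_dbox`): if the channel dimension stays in `[Δ₁, Δ₂]` on the box (`Δ₁` above the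
   scalar unitarity bound), every label's lower parameter corners are `≥ −5/8`, and per label a ratio
   `q_L ≥ 1` with `q_L y' < 1` passes `DiagRatioTest` at the four corners `(parAHi, Δ₁)`, `(parAHi, Δ₂)`,
   `(parBHi, Δ₁)`, `(parBHi, Δ₂)` at level `N + 1` (`N ≥ 3`), then `hU` holds with
   `Ua L = diagBoxBound (parALo L) (parAHi L) Δ₁ Δ₂ N q_L y'` and the analogous `Ub L` — finitely many
   closed-form rational checks per label, uniform in `D`.
3. **The `F`-table on a box with closed-form diagonal bounds** (`fTable_on_dbox_of_cornerTests`):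
   `O2ExtBlockTables.fTable_on_dbox` with `hU` discharged — every hypothesis left is a closed-form check.

NON-CLAIMS. Soundness lemmas only: no table is instantiated, no certificate is checked, nothing is
asserted about the O(2) model; the file only removes the last non-closed-form hypothesis shape from the
`F`-table chain of `O2ExtBlockTables` (the numbers themselves are a client certificate's business).
Filed as kind `definition` (corner tables and the `Prop`-valued test bundle).
-/

noncomputable section

namespace Literature.MathematicalPhysics.QuantumFieldTheory.O2ExtDiagBounds

open Set Finset
open Literature.MathematicalPhysics.QuantumFieldTheory.ConformalBootstrap3D
open O2ThreeScalarCrossing O2ThreeScalarSystem O2OPEScanBridge O2ExtFormEnclosure O2ExtBlockTables O2DimBox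

/-! ## 1. Corner boxes of the block parameters on a box of external dimensions -/

/-- `Δ_ij(L)` with the FIRST dimension read from `X` and the SECOND from `Y` (same table as
`O2ThreeScalarSystem.d12`; `d12Mix D D = d12 D`). [cite: ChesterEtAl2020, §2.1 (`F^{ij,kl}_{∓,Δ,ℓ}`)] -/
def d12Mix (X Y : Dims) : Label → ℝ
  | .φφφφ => 0
  | .tttt => 0
  | .ssss => 0
  | .ttφφ => 0
  | .ttss => 0
  | .φφss => 0
  | .tφtφ => X.Δt - Y.Δφ
  | .φttφ => X.Δφ - Y.Δt
  | .φsφs => X.Δφ - Y.Δs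
  | .sφφs => X.Δs - Y.Δφ
  | .φsφt => X.Δφ - Y.Δs
  | .sφφt => X.Δs - Y.Δφ
  | .tsts => X.Δt - Y.Δs
  | .stts => X.Δs - Y.Δt
  | .φφst => 0

/-- `Δ_kl(L)` with the FIRST dimension read from `X` and the SECOND from `Y` (same table as
`O2ThreeScalarSystem.d34`; `d34Mix D D = d34 D`). [cite: ChesterEtAl2020, §2.1 (`F^{ij,kl}_{∓,Δ,ℓ}`)] -/
def d34Mix (X Y : Dims) : Label → ℝ
  | .φφφφ => 0
  | .tttt => 0
  | .ssss => 0
  | .ttφφ => 0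
  | .ttss => 0
  | .φφss => 0
  | .tφtφ => X.Δt - Y.Δφ
  | .φttφ => X.Δt - Y.Δφ
  | .φsφs => X.Δφ - Y.Δs
  | .sφφs => X.Δφ - Y.Δs
  | .φsφt => X.Δφ - Y.Δt
  | .sφφt => X.Δφ - Y.Δt
  | .tsts => X.Δt - Y.Δs
  | .stts => X.Δt - Y.Δs
  | .φφst => X.Δs - Y.Δt

/-- `d12Mix D D = d12 D`. [cite: ChesterEtAl2020, §2.1 (`F^{ij,kl}_{∓,Δ,ℓ}`)] -/
theorem d12Mix_self (D : Dims) (L : Label) : d12Mix D D L = d12 D L := by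
  cases L <;> rfl

/-- `d34Mix D D = d34 D`. [cite: ChesterEtAl2020, §2.1 (`F^{ij,kl}_{∓,Δ,ℓ}`)] -/
theorem d34Mix_self (D : Dims) (L : Label) : d34Mix D D L = d34 D L := by
  cases L <;> rfl

/-- **`Δ_ij(L)` on a box lies between its mixed corners**: `d12Mix lo hi L ≤ Δ_ij(L)(D) ≤ d12Mix hi lo L`
for `D ∈ [lo, hi]`. [cite: ChesterEtAl2020, §2.1, §3.3 (scanning over external dimensions)]
[cite: Moore1979, §2.2 eq. (2.19) (interval subtraction)] -/
theorem d12_mem_Icc {lo hi D : Dims} (h : InDimBox lo hi D) (L : Label) :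
    d12 D L ∈ Icc (d12Mix lo hi L) (d12Mix hi lo L) := by
  obtain ⟨⟨hs1, hs2⟩, ⟨hp1, hp2⟩, ⟨ht1, ht2⟩⟩ := h
  cases L <;> simp only [d12, d12Mix, Set.mem_Icc] <;> constructor <;> linarith

/-- **`Δ_kl(L)` on a box lies between its mixed corners**: `d34Mix lo hi L ≤ Δ_kl(L)(D) ≤ d34Mix hi lo L`
for `D ∈ [lo, hi]`. [cite: ChesterEtAl2020, §2.1, §3.3 (scanning over external dimensions)]
[cite: Moore1979, §2.2 eq. (2.19) (interval subtraction)] -/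
theorem d34_mem_Icc {lo hi D : Dims} (h : InDimBox lo hi D) (L : Label) :
    d34 D L ∈ Icc (d34Mix lo hi L) (d34Mix hi lo L) := by
  obtain ⟨⟨hs1, hs2⟩, ⟨hp1, hp2⟩, ⟨ht1, ht2⟩⟩ := h
  cases L <;> simp only [d34, d34Mix, Set.mem_Icc] <;> constructor <;> linarith

/-- Lower corner of the first block parameter `a_L = −Δ_ij(L)/2` on the box `[lo, hi]`.
[cite: DolanOsborn2004, §3 eq. (3.11)] -/
def parALo (lo hi : Dims) (L : Label) : ℝ := -d12Mix hi lo L / 2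

/-- Upper corner of the first block parameter `a_L = −Δ_ij(L)/2` on the box `[lo, hi]`.
[cite: DolanOsborn2004, §3 eq. (3.11)] -/
def parAHi (lo hi : Dims) (L : Label) : ℝ := -d12Mix lo hi L / 2

/-- Lower corner of the second block parameter `b_L = Δ_kl(L)/2` on the box `[lo, hi]`.
[cite: DolanOsborn2004, §3 eq. (3.11)] -/
def parBLo (lo hi : Dims) (L : Label) : ℝ := d34Mix lo hi L / 2

/-- Upper corner of the second block parameter `b_L = Δ_kl(L)/2` on the box `[lo, hi]`.
[cite: DolanOsborn2004, §3 eq. (3.11)] -/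
def parBHi (lo hi : Dims) (L : Label) : ℝ := d34Mix hi lo L / 2

/-- **`a_L(D) ∈ [parALo lo hi L, parAHi lo hi L]` for `D ∈ [lo, hi]`.**
[cite: DolanOsborn2004, §3 eq. (3.11)] [cite: Moore1979, §2.2 eq. (2.19)] -/
theorem blockParA_mem_Icc {lo hi D : Dims} (h : InDimBox lo hi D) (L : Label) :
    blockParA D L ∈ Icc (parALo lo hi L) (parAHi lo hi L) := by
  have h12 := d12_mem_Icc h L
  unfold blockParA parALo parAHi
  exact ⟨by linarith [h12.2], by linarith [h12.1]⟩

/-- **`b_L(D) ∈ [parBLo lo hi L, parBHi lo hi L]` for `D ∈ [lo, hi]`.**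
[cite: DolanOsborn2004, §3 eq. (3.11)] [cite: Moore1979, §2.2 eq. (2.19)] -/
theorem blockParB_mem_Icc {lo hi D : Dims} (h : InDimBox lo hi D) (L : Label) :
    blockParB D L ∈ Icc (parBLo lo hi L) (parBHi lo hi L) := by
  have h34 := d34_mem_Icc h L
  unfold blockParB parBLo parBHi
  exact ⟨by linarith [h34.1], by linarith [h34.2]⟩

/-! ## 2. The diagonal-bound table on a box from per-label corner tests -/

/-- **PER-LABEL CORNER TESTS** for the labels `S` on the box `[lo, hi]`, channel dimension range
`[Δ₁, Δ₂]`, common point `y'`, head length `N` and per-label ratios `q`: both lower parameter corners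
`≥ −5/8` (the regime of `diagSeriesAB_le_boxBound_wide`), `1 ≤ q_L`, `q_L y' < 1`, and `DiagRatioTest` at
the upper parameter corners against both ends of the dimension range at level `N + 1` — finitely many
closed-form rational inequalities. [cite: DolanOsborn2004, §3 eqs. (3.11)–(3.12)]
[cite: Moore1979, §2.2 eq. (2.19), §2.4 (machine-checkable comparisons)] -/
def DiagCornerTests (lo hi : Dims) (S : List Label) (Δ₁ Δ₂ y' : ℝ) (N : ℕ) (q : Label → ℝ) : Prop :=
  ∀ L ∈ S, (-5 / 8 ≤ parALo lo hi L ∧ -5 / 8 ≤ parBLo lo hi L) ∧ (1 ≤ q L ∧ q L * y' < 1) ∧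
    (DiagRatioTest (parAHi lo hi L) Δ₁ (N + 1) (q L) ∧ DiagRatioTest (parAHi lo hi L) Δ₂ (N + 1) (q L)) ∧
    (DiagRatioTest (parBHi lo hi L) Δ₁ (N + 1) (q L) ∧ DiagRatioTest (parBHi lo hi L) Δ₂ (N + 1) (q L))

/-- The closed-form diagonal bound of the FIRST parameter of a label on the box: `diagBoxBound` on
`[parALo, parAHi] × [Δ₁, Δ₂]`. [cite: DolanOsborn2004, §3 eqs. (3.11)–(3.12)] -/
def diagUa (lo hi : Dims) (Δ₁ Δ₂ : ℝ) (N : ℕ) (q : Label → ℝ) (y' : ℝ) (L : Label) : ℝ :=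
  diagBoxBound (parALo lo hi L) (parAHi lo hi L) Δ₁ Δ₂ N (q L) y'

/-- The closed-form diagonal bound of the SECOND parameter of a label on the box: `diagBoxBound` on
`[parBLo, parBHi] × [Δ₁, Δ₂]`. [cite: DolanOsborn2004, §3 eqs. (3.11)–(3.12)] -/
def diagUb (lo hi : Dims) (Δ₁ Δ₂ : ℝ) (N : ℕ) (q : Label → ℝ) (y' : ℝ) (L : Label) : ℝ :=
  diagBoxBound (parBLo lo hi L) (parBHi lo hi L) Δ₁ Δ₂ N (q L) y'

/-- **The diagonal-bound table at every `D` of a dimension box, in closed form.** If the channel dimension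
`Δc(D)` stays in `[Δ₁, Δ₂]` on the box with `Δ₁` strictly above the scalar unitarity bound, `0 < y' < 1`,
`N ≥ 3`, and the per-label corner tests pass, then for every `D ∈ [lo, hi]` the hypothesis `hU` of
`O2ExtBlockTables.fTable_on_dbox` holds with the closed-form numbers `diagUa`, `diagUb`:
`D(a_L(D); Δc(D); y') ≤ diagUa … L` and `D(b_L(D); Δc(D); y') ≤ diagUb … L` for all `L ∈ S`.
[cite: DolanOsborn2004, §3 eqs. (3.11)–(3.12)] [cite: ChesterEtAl2020, §3.3 (Algorithm 1:
`Q_i = α_i(V⃗_ext)`; scanning over external dimensions)] [cite: Moore1979, §2.2 eq. (2.19), §2.4] -/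
theorem diagBoundTable_on_dbox {lo hi : Dims} {S : List Label} {Δc : Dims → ℝ} {Δ₁ Δ₂ y' : ℝ}
    {N : ℕ} {q : Label → ℝ} (hΔ₁ : unitarityBound3D 0 < Δ₁)
    (hΔc : ∀ D, InDimBox lo hi D → Δ₁ ≤ Δc D ∧ Δc D ≤ Δ₂) (hN : 3 ≤ N) (hy0 : 0 < y')
    (hy1 : y' < 1) (hT : DiagCornerTests lo hi S Δ₁ Δ₂ y' N q) :
    ∀ D, InDimBox lo hi D →
      DiagBoundTable D S (Δc D) y' (diagUa lo hi Δ₁ Δ₂ N q y') (diagUb lo hi Δ₁ Δ₂ N q y') := by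
  intro D hD L hL
  obtain ⟨⟨ha, hb⟩, ⟨h1, hqy⟩, ⟨htA₁, htA₂⟩, ⟨htB₁, htB₂⟩⟩ := hT L hL
  obtain ⟨hΔl, hΔu⟩ := hΔc D hD
  have hA := blockParA_mem_Icc hD L
  have hB := blockParB_mem_Icc hD L
  exact ⟨diagSeriesAB_le_boxBound_wide hΔ₁ hΔl hΔu ha hA.1 hA.2 hN hy0 hy1 h1 hqy htA₁ htA₂,
    diagSeriesAB_le_boxBound_wide hΔ₁ hΔl hΔu hb hB.1 hB.2 hN hy0 hy1 h1 hqy htB₁ htB₂⟩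

/-- **The three external channels.** With `Δc = Δ_s` (labels `labels0p`), `Δ_φ` (`labels1`) or `Δ_t`
(`labels2p`) the dimension range is the corresponding edge `[lo.Δ_*, hi.Δ_*]` of the box itself, so the
corner tests are literally finitely many rational inequalities in the box corners.
[cite: ChesterEtAl2020, §3.3 (Algorithm 1; scanning over external dimensions)]
[cite: DolanOsborn2004, §3 eqs. (3.11)–(3.12)] -/
theorem diagBoundTables_ext_on_dbox {lo hi : Dims} {y' : ℝ} {N : ℕ} {q₀ q₁ q₂ : Label → ℝ}
    (hs : unitarityBound3D 0 < lo.Δs) (hφ : unitarityBound3D 0 < lo.Δφ) (ht : unitarityBound3D 0 < lo.Δt)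
    (hN : 3 ≤ N) (hy0 : 0 < y') (hy1 : y' < 1)
    (hT₀ : DiagCornerTests lo hi labels0p lo.Δs hi.Δs y' N q₀)
    (hT₁ : DiagCornerTests lo hi labels1 lo.Δφ hi.Δφ y' N q₁)
    (hT₂ : DiagCornerTests lo hi labels2p lo.Δt hi.Δt y' N q₂) :
    (∀ D, InDimBox lo hi D → DiagBoundTable D labels0p D.Δs y'
        (diagUa lo hi lo.Δs hi.Δs N q₀ y') (diagUb lo hi lo.Δs hi.Δs N q₀ y')) ∧
    (∀ D, InDimBox lo hi D → DiagBoundTable D labels1 D.Δφ y'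
        (diagUa lo hi lo.Δφ hi.Δφ N q₁ y') (diagUb lo hi lo.Δφ hi.Δφ N q₁ y')) ∧
    (∀ D, InDimBox lo hi D → DiagBoundTable D labels2p D.Δt y'
        (diagUa lo hi lo.Δt hi.Δt N q₂ y') (diagUb lo hi lo.Δt hi.Δt N q₂ y')) :=
  ⟨diagBoundTable_on_dbox hs (fun _ hD => hD.1) hN hy0 hy1 hT₀,
    diagBoundTable_on_dbox hφ (fun _ hD => hD.2.1) hN hy0 hy1 hT₁,
    diagBoundTable_on_dbox ht (fun _ hD => hD.2.2) hN hy0 hy1 hT₂⟩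

/-- **`F`-table at every `D` of a dimension box with the diagonal bounds in closed form**:
`O2ExtBlockTables.fTable_on_dbox` with its hypothesis `hU` discharged by `diagBoundTable_on_dbox` — every
remaining hypothesis is a closed-form check uniform in `D` (head enclosures, radii above `tailRad` with
`Ua = diagUa`, `Ub = diagUb`, power corners, node domination) plus the per-label corner tests.
[cite: ChesterEtAl2020, §3.3 (Algorithm 1: `Q_i = α_i(V⃗_ext)`; scanning over external dimensions)]
[cite: DolanOsborn2004, §3 eqs. (3.9)–(3.12)] [cite: Moore1979, §2.2 eqs. (2.14), (2.15), (2.19), §2.4] -/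
theorem fTable_on_dbox_of_cornerTests (F : ScanFunctional) {lo hi : Dims} {S : List Label}
    {Δc : Dims → ℝ} {Δ₁ Δ₂ y' : ℝ} {N : ℕ} {q t : Label → ℝ} {Mp Mm : Fin F.M → ℝ}
    {Hlo Hhi Klo Khi Rp Rm P₁ P₂ Q₁ Q₂ : Fin F.M → Label → ℝ}
    (hΔ₁ : unitarityBound3D 0 < Δ₁) (hΔc : ∀ D, InDimBox lo hi D → Δ₁ ≤ Δc D ∧ Δc D ≤ Δ₂)
    (hne : ∀ D, InDimBox lo hi D → Δc D ≠ 1) (ht : ∀ L, 0 < t L) (hy0 : 0 < y') (hy1 : y' < 1)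
    (hN : 3 ≤ N) (hdom : NodeDom F y' Mp Mm)
    (hH : ∀ D, InDimBox lo hi D → HeadTable F D S (Δc D) N Hlo Hhi Klo Khi)
    (hT : DiagCornerTests lo hi S Δ₁ Δ₂ y' N q)
    (hR : ∀ D, InDimBox lo hi D → RadTable F D S (Δc D) N y' t
      (diagUa lo hi Δ₁ Δ₂ N q y') (diagUb lo hi Δ₁ Δ₂ N q y') Mp Mm Rp Rm)
    (hP : PowBoxTable F lo hi S P₁ P₂ Q₁ Q₂) :
    ∀ D, InDimBox lo hi D →
      FTable F D S (Δc D)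
        (fAm P₁ P₂ Q₁ Q₂ (fun m L => Hlo m L - Rp m L) (fun m L => Khi m L + Rm m L))
        (fBm P₁ P₂ Q₁ Q₂ (fun m L => Hhi m L + Rp m L) (fun m L => Klo m L - Rm m L))
        (fAp P₁ P₂ Q₁ Q₂ (fun m L => Hlo m L - Rp m L) (fun m L => Klo m L - Rm m L))
        (fBp P₁ P₂ Q₁ Q₂ (fun m L => Hhi m L + Rp m L) (fun m L => Khi m L + Rm m L)) :=
  fTable_on_dbox F (fun D hD => ⟨lt_of_lt_of_le hΔ₁ (hΔc D hD).1, hne D hD⟩) ht hy1 hdom hH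
    (diagBoundTable_on_dbox hΔ₁ hΔc hN hy0 hy1 hT) hR hP

end Literature.MathematicalPhysics.QuantumFieldTheory.O2ExtDiagBounds

end
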